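import Literature.NumberTheory.EllipticCurves.BinaryQuarticMinimisationProofs
import Mathlib.NumberTheory.Padics.PadicNorm
import Mathlib.Data.ZMod.Basic
import HarnessLib

/-!
# Birch–Swinnerton-Dyer's minimisation lemma at a prime `p ≥ 5` (Bhargava–Shankar, Lemma 5.3),
# proved following Stoll–Cremona

`Proofs` companion of `Literature/NumberTheory/EllipticCurves/BinaryQuarticMinimisation.lean`,
discharging the named fact
`Literature.NumberTheory.EllipticCurves.bsd_minimisation_prime_five_le` (Bhargava–Shankar,
*Binary quartic forms having bounded invariants…*, Ann. of Math. 181 (2015), held arXiv text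
Lemma 5.3 = B. J. Birch, H. P. F. Swinnerton-Dyer, *Notes on elliptic curves. I*, J. reine angew.
Math. 212 (1963), Lemma 3): *for a prime `p ≥ 5` and an integral binary quartic form `f` with
`p⁴ ∣ I(f)`, `p⁶ ∣ J(f)` such that `z² = f(x, y)` is soluble over `ℚ_p`, there is an integral form
equivalent to `f` with invariants `p⁻⁴ I(f)`, `p⁻⁶ J(f)`.* This is one of the four printed inputs
of Bhargava–Shankar's `2`-Selmer parametrization (Thm 5.6), assembled in
`BinaryQuarticMinimisationProofs.lean`; fourth layer of the decomposition of
`Literature.NumberTheory.EllipticCurves.averageRankLE_three_halves`.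

## Source followed

M. Stoll, J. E. Cremona, *Minimal models for 2-coverings of elliptic curves*, LMS J. Comput.
Math. 5 (2002) 220–243, doi:10.1112/S1461157000000760 (held), Appendix A, pp. 237–238:
**Lemma A.1** (three level-lowering moves), **Lemma A.2** (for `p ≠ 3`: a minimal quartic of
positive level has a quadruple root modulo `π`; constructive), **Proposition A.3** (`p ≥ 5`;
"The proof of [BSD, Lemma 3] for `ℚ_p` goes over unchanged", Prop. 4.2). In the printed
terminology (`level(Q) = ⌊min(v(I)/4, v(J)/6)⌋`, `v(Q) = min v(coeff)`), the fact to prove is: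
an integral `ℚ_p`-soluble `Q` of level `≥ 1` is `ℚ`-equivalent to an integral form whose
invariants are exactly `(p⁻⁴ I, p⁻⁶ J)`. All three moves of Lemma A.1 lower `(I, J)` by exactly
`(p⁴, p⁶)`, and all normalisations are by `SL₂(ℤ)` (which fixes `I`, `J`), so the printed proof
yields the exact statement; it does not use `Δ ≠ 0`.

## Proof architecture (as printed, pp. 237–238)

* §A explicit substitutions: shears `(x,y) ↦ (x + ry, y)`, `(x,y) ↦ (x, sx + y)`, the rotation
  `(x,y) ↦ (−y, x)`, diagonal maps;
* §B **Lemma A.1**: `v ≥ (0,1,2,3,4)` ⇒ `Q(x, z/p)`; `v(c,d,e) ≥ (2,4,6)` ⇒ `p² Q(x, z/p²)`;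
  `v(Q) ≥ 2` ⇒ `Q/p²` — each integral, `ℚ`-equivalent, with invariants `(p⁻⁴I, p⁻⁶J)`
  (`reduce_one/two/three`);
* §C **the multiple root** (first paragraph of the proof of Lemma A.2): over a field with
  `2, 3 ≠ 0`, a nonzero form with `I = J = 0` has a root of multiplicity `≥ 3` *defined over the
  field*; explicitly, after depressing (`b = 0`), either `c = d = e = 0` (quadruple root) or
  `f = a (x − ρy)³ (x + 3ρy)` with `ρ = −3d/(4c)`; shears and the rotation bring the form to
  `a x⁴` or `b x³y` (`normalForm`), and the matrices lift to `SL₂(ℤ)` (`exists_sl2_shape`);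
* §D the **valuation chases** of the proofs of Lemma A.2 and Prop. A.3(3),(4) (including Serf's
  remark on `6cI − J`), as divisibility statements in `ℤ` (`chase_quadruple₀`, `chase_triple₀`,
  `chase_quadruple₁`, `chase_triple₁`), and the shear parameter `3bα ≡ −c (mod p²)`
  (`exists_shear`);
* the **solubility step** of Prop. A.3(4): `v(a,b,c,d,e) = (1,≥2,≥2,≥3,3)` makes `v(Q(x,z))` odd
  for all `(x, z) ≠ 0`, contradicting `ℚ_p`-solubility (`not_isSoluble_of_valuations`, with
  `p`-adic norms);
* §E **Prop. A.3 assembled** by the case distinction `v(Q) ≥ 2` / `v(Q) = 1` / `v(Q) = 0` and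
  quadruple / triple root: `bsd_minimisation_prime_five_le_holds`.

## References

* [StollCremona2002] M. Stoll, J. E. Cremona, LMS J. Comput. Math. 5 (2002) 220–243,
  doi:10.1112/S1461157000000760: Def. 2.1, 2.3, Prop. 4.2, Lemma A.1, Lemma A.2, Prop. A.3.
* [BhargavaShankarAnnals2015] M. Bhargava, A. Shankar, Ann. of Math. (2) 181 (2015) 191–242 =
  arXiv:1006.1002, Lemma 5.3 (arXiv:1006.1002v2 numbering).
* B. J. Birch, H. P. F. Swinnerton-Dyer, *Notes on elliptic curves. I*, J. reine angew. Math. 212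
  (1963) 7–25, Lemma 3 (not held; quoted through the two sources above).

## Design

Theorems only (`--kind proof`); no statement file is touched; `noncomputable section`,
`open scoped Classical` as in the files served. Valuations are expressed as divisibilities
`(p : ℤ) ^ k ∣ ·` (no junk values), `p`-adic sizes in the solubility step by the norm of `ℚ_[p]`.
-/

noncomputable section

open scoped Classical

namespace Literature.NumberTheory.EllipticCurves

namespace BinaryQuartic

/-! ## §A Elementary substitutions -/

section Subst

variable {R : Type*} [CommRing R]

/-- The lower shear `(x, y) ↦ (x + r y, y)`, i.e. `f(x + r y, y)`. [folklore] -/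
theorem subst_lowerShear (f : BinaryQuartic R) (r : R) :
    f.subst !![1, 0; r, 1] =
      ⟨f.a, 4 * f.a * r + f.b, 6 * f.a * r ^ 2 + 3 * f.b * r + f.c,
        4 * f.a * r ^ 3 + 3 * f.b * r ^ 2 + 2 * f.c * r + f.d,
        f.a * r ^ 4 + f.b * r ^ 3 + f.c * r ^ 2 + f.d * r + f.e⟩ := by
  ext <;> simp [subst]

/-- The upper shear `(x, y) ↦ (x, s x + y)`, i.e. `f(x, s x + y)`. [folklore] -/
theorem subst_upperShear (f : BinaryQuartic R) (s : R) :
    f.subst !![1, s; 0, 1] =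
      ⟨f.a + f.b * s + f.c * s ^ 2 + f.d * s ^ 3 + f.e * s ^ 4,
        f.b + 2 * f.c * s + 3 * f.d * s ^ 2 + 4 * f.e * s ^ 3,
        f.c + 3 * f.d * s + 6 * f.e * s ^ 2, f.d + 4 * f.e * s, f.e⟩ := by
  ext <;> simp [subst]

/-- The rotation `(x, y) ↦ (-y, x)` (determinant `1`), exchanging the roots `0` and `∞`. [folklore] -/
theorem subst_swap (f : BinaryQuartic R) :
    f.subst !![0, 1; -1, 0] = ⟨f.e, -f.d, f.c, -f.b, f.a⟩ := by
  ext <;> simp [subst] <;> ring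

/-- Diagonal substitutions `(x, y) ↦ (u x, v y)`. [folklore] -/
theorem subst_diagonal (f : BinaryQuartic R) (u v : R) :
    f.subst !![u, 0; 0, v] =
      ⟨f.a * u ^ 4, f.b * u ^ 3 * v, f.c * u ^ 2 * v ^ 2, f.d * u * v ^ 3, f.e * v ^ 4⟩ := by
  ext <;> simp [subst]

/-- The lower shear is unimodular. [folklore] -/
theorem det_lowerShear (r : R) : (!![1, 0; r, 1] : Matrix (Fin 2) (Fin 2) R).det = 1 := by
  rw [Matrix.det_fin_two_of]; ring

/-- The upper shear is unimodular. [folklore] -/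
theorem det_upperShear (s : R) : (!![1, s; 0, 1] : Matrix (Fin 2) (Fin 2) R).det = 1 := by
  rw [Matrix.det_fin_two_of]; ring

/-- The rotation is unimodular. [folklore] -/
theorem det_swap : (!![0, 1; -1, 0] : Matrix (Fin 2) (Fin 2) R).det = 1 := by
  rw [Matrix.det_fin_two_of]; ring

end Subst

/-! ## §B The three level-lowering moves of Stoll–Cremona, Lemma A.1 -/

section Reduce

/-- **Stoll–Cremona, Lemma A.1(1)**: if `v(a,b,c,d,e) ≥ (0,1,2,3,4)` then `Q(x, z/p)` is
integral, `ℚ`-equivalent to `Q`, with invariants exactly `p⁻⁴ I`, `p⁻⁶ J`.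
[cite: StollCremona2002, Lemma A.1] -/
theorem reduce_one {p : ℤ} (hp : p ≠ 0) (f : BinaryQuartic ℤ) (hb : p ∣ f.b) (hc : p ^ 2 ∣ f.c)
    (hd : p ^ 3 ∣ f.d) (he : p ^ 4 ∣ f.e) :
    ∃ f' : BinaryQuartic ℤ, KEquiv (f.map (Int.castRingHom ℚ)) (f'.map (Int.castRingHom ℚ)) ∧
      p ^ 4 * f'.I = f.I ∧ p ^ 6 * f'.J = f.J := by
  obtain ⟨b₁, hb₁⟩ := hb
  obtain ⟨c₁, hc₁⟩ := hc
  obtain ⟨d₁, hd₁⟩ := hd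
  obtain ⟨e₁, he₁⟩ := he
  have hp' : (p : ℚ) ≠ 0 := by exact_mod_cast hp
  refine ⟨⟨f.a, b₁, c₁, d₁, e₁⟩, ?_, ?_, ?_⟩
  · refine ⟨1, one_ne_zero, !![1, 0; 0, (p : ℚ)⁻¹], ?_, ?_⟩
    · rw [Matrix.det_fin_two_of]; simp [hp']
    · rw [one_pow, one_smul, subst_diagonal]
      ext <;> simp [map, hb₁, hc₁, hd₁, he₁] <;> field_simp
  · simp only [I]; rw [hb₁, hc₁, hd₁, he₁]; ring
  · simp only [J]; rw [hb₁, hc₁, hd₁, he₁]; ring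

/-- **Stoll–Cremona, Lemma A.1(2)**: if `v(c,d,e) ≥ (2,4,6)` then `p² Q(x, z/p²)` is integral,
`ℚ`-equivalent to `Q`, with invariants exactly `p⁻⁴ I`, `p⁻⁶ J`. [cite: StollCremona2002, Lemma A.1] -/
theorem reduce_two {p : ℤ} (hp : p ≠ 0) (f : BinaryQuartic ℤ) (hc : p ^ 2 ∣ f.c)
    (hd : p ^ 4 ∣ f.d) (he : p ^ 6 ∣ f.e) :
    ∃ f' : BinaryQuartic ℤ, KEquiv (f.map (Int.castRingHom ℚ)) (f'.map (Int.castRingHom ℚ)) ∧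
      p ^ 4 * f'.I = f.I ∧ p ^ 6 * f'.J = f.J := by
  obtain ⟨c₁, hc₁⟩ := hc
  obtain ⟨d₁, hd₁⟩ := hd
  obtain ⟨e₁, he₁⟩ := he
  have hp' : (p : ℚ) ≠ 0 := by exact_mod_cast hp
  refine ⟨⟨p ^ 2 * f.a, f.b, c₁, d₁, e₁⟩, ?_, ?_, ?_⟩
  · refine ⟨p, hp', !![1, 0; 0, ((p : ℚ) ^ 2)⁻¹], ?_, ?_⟩
    · rw [Matrix.det_fin_two_of]; simp [hp']
    · rw [subst_diagonal]
      ext <;> simp [map, hc₁, hd₁, he₁] <;> field_simp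
  · simp only [I]; rw [hc₁, hd₁, he₁]; ring
  · simp only [J]; rw [hc₁, hd₁, he₁]; ring

/-- **Stoll–Cremona, Lemma A.1(3)**: if `v(Q) ≥ 2` then `p⁻² Q` is integral, `ℚ`-equivalent to
`Q`, with invariants exactly `p⁻⁴ I`, `p⁻⁶ J`. [cite: StollCremona2002, Lemma A.1] -/
theorem reduce_three {p : ℤ} (hp : p ≠ 0) (f : BinaryQuartic ℤ) (ha : p ^ 2 ∣ f.a)
    (hb : p ^ 2 ∣ f.b) (hc : p ^ 2 ∣ f.c) (hd : p ^ 2 ∣ f.d) (he : p ^ 2 ∣ f.e) :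
    ∃ f' : BinaryQuartic ℤ, KEquiv (f.map (Int.castRingHom ℚ)) (f'.map (Int.castRingHom ℚ)) ∧
      p ^ 4 * f'.I = f.I ∧ p ^ 6 * f'.J = f.J := by
  obtain ⟨a₁, ha₁⟩ := ha
  obtain ⟨b₁, hb₁⟩ := hb
  obtain ⟨c₁, hc₁⟩ := hc
  obtain ⟨d₁, hd₁⟩ := hd
  obtain ⟨e₁, he₁⟩ := he
  have hp' : (p : ℚ) ≠ 0 := by exact_mod_cast hp
  refine ⟨⟨a₁, b₁, c₁, d₁, e₁⟩, ?_, ?_, ?_⟩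
  · refine ⟨(p : ℚ)⁻¹, inv_ne_zero hp', 1, by simp, ?_⟩
    rw [subst_one]
    ext <;> simp [map, ha₁, hb₁, hc₁, hd₁, he₁] <;> field_simp
  · simp only [I]; rw [ha₁, hb₁, hc₁, hd₁, he₁]; ring
  · simp only [J]; rw [ha₁, hb₁, hc₁, hd₁, he₁]; ring

end Reduce

/-! ## §D Divisibility bookkeeping -/

section Dvd

variable {P : ℤ}

/-- `P^i ∣ x`, `P^j ∣ y` give `P^(i+j) ∣ k x y` (valuation of a product). [folklore] -/
theorem pow_dvd_mul₂ {x y : ℤ} {i j : ℕ} (hx : P ^ i ∣ x) (hy : P ^ j ∣ y) (k : ℤ) :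
    P ^ (i + j) ∣ k * x * y := by
  rw [pow_add, mul_assoc]; exact (mul_dvd_mul hx hy).mul_left k

/-- Three factors: `P^(i+j+l) ∣ k x y z`. [folklore] -/
theorem pow_dvd_mul₃ {x y z : ℤ} {i j l : ℕ} (hx : P ^ i ∣ x) (hy : P ^ j ∣ y) (hz : P ^ l ∣ z)
    (k : ℤ) : P ^ (i + j + l) ∣ k * x * y * z := by
  rw [pow_add, pow_add, show k * x * y * z = k * (x * y * z) by ring]
  exact (mul_dvd_mul (mul_dvd_mul hx hy) hz).mul_left k

/-- Lowering the exponent in `P^j ∣ x`. [folklore] -/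
theorem pow_dvd_of_le {x : ℤ} {i j : ℕ} (h : P ^ j ∣ x) (hij : i ≤ j) : P ^ i ∣ x :=
  (pow_dvd_pow P hij).trans h

/-- `v(x²) ≥ 2 v(x)`. [folklore] -/
theorem pow_dvd_sq_of_dvd {x : ℤ} {i : ℕ} (h : P ^ i ∣ x) : P ^ (2 * i) ∣ x ^ 2 := by
  rw [mul_comm, pow_mul]; exact pow_dvd_pow_of_dvd h 2

/-- `v(x³) ≥ 3 v(x)`. [folklore] -/
theorem pow_dvd_cube_of_dvd {x : ℤ} {i : ℕ} (h : P ^ i ∣ x) : P ^ (3 * i) ∣ x ^ 3 := by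
  rw [mul_comm, pow_mul]; exact pow_dvd_pow_of_dvd h 3

/-- `P^(2k) ∣ d²` gives `P^k ∣ d`. [folklore] -/
theorem pow_dvd_of_sq_even {d : ℤ} {k : ℕ} (h : P ^ (2 * k) ∣ d ^ 2) : P ^ k ∣ d := by
  rw [mul_comm, pow_mul] at h
  exact (Int.pow_dvd_pow_iff two_ne_zero).mp h

/-- `P^(2k+1) ∣ d²` gives `P^(k+1) ∣ d` for `P` prime (`2 v(d) ≥ 2k + 1`). [folklore] -/
theorem pow_dvd_of_sq_odd (hP : Prime P) {d : ℤ} {k : ℕ} (h : P ^ (2 * k + 1) ∣ d ^ 2) :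
    P ^ (k + 1) ∣ d := by
  obtain ⟨d', rfl⟩ : P ^ k ∣ d := pow_dvd_of_sq_even (pow_dvd_of_le h (by omega))
  rw [pow_succ]
  refine mul_dvd_mul_left _ (hP.dvd_of_dvd_pow (n := 2) ?_)
  rw [mul_pow, ← pow_mul, mul_comm k 2, pow_succ] at h
  exact (mul_dvd_mul_iff_left (pow_ne_zero _ hP.ne_zero)).mp h

/-- `P⁴ ∣ c³` gives `P² ∣ c` for `P` prime (`3 v(c) ≥ 4`). [folklore] -/
theorem sq_dvd_of_pow_four_dvd_cube (hP : Prime P) {c : ℤ} (h : P ^ 4 ∣ c ^ 3) : P ^ 2 ∣ c := by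
  obtain ⟨c', rfl⟩ : P ∣ c := hP.dvd_of_dvd_pow ((dvd_pow_self P four_ne_zero).trans h)
  rw [sq]
  refine mul_dvd_mul_left _ (hP.dvd_of_dvd_pow (n := 3) ?_)
  rw [mul_pow, show (4 : ℕ) = 3 + 1 from rfl, pow_succ] at h
  exact (mul_dvd_mul_iff_left (pow_ne_zero _ hP.ne_zero)).mp h

/-- Constants coprime to a prime `P ∤ 6`. [folklore] -/
theorem not_dvd_consts (hP : Prime P) (h2 : ¬ P ∣ 2) (h3 : ¬ P ∣ 3) :
    ¬ P ∣ 3 ∧ ¬ P ∣ 8 ∧ ¬ P ∣ 12 ∧ ¬ P ∣ 27 := by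
  refine ⟨h3, fun h ↦ h2 (hP.dvd_of_dvd_pow (n := 3) (by norm_num; exact h)),
    fun h ↦ ?_, fun h ↦ h3 (hP.dvd_of_dvd_pow (n := 3) (by norm_num; exact h))⟩
  rcases hP.dvd_mul.mp (show P ∣ 4 * 3 by norm_num; exact h) with h4 | h3'
  · exact h2 (hP.dvd_of_dvd_pow (n := 2) (by norm_num; exact h4))
  · exact h3 h3'

/-- Shear parameter: `3 b r ≡ -c (mod P²)` with `P ∣ r` (Stoll–Cremona, proof of Lemma A.2).
[cite: StollCremona2002, Lemma A.2 (proof)] -/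
theorem exists_shear (hP : Prime P) (h3 : ¬ P ∣ 3) {b c : ℤ} (hb : ¬ P ∣ b) (hc : P ∣ c) :
    ∃ r : ℤ, P ∣ r ∧ P ^ 2 ∣ 3 * b * r + c := by
  have hcop : IsCoprime (P ^ 2) (3 * b) := by
    apply IsCoprime.pow_left
    exact (Prime.coprime_iff_not_dvd hP).mpr (fun h ↦ (hP.dvd_mul.mp h).elim h3 hb)
  obtain ⟨u, v, huv⟩ := hcop
  exact ⟨-(c * v), dvd_neg.mpr (hc.mul_right v), ⟨c * u, by linear_combination (-c) * huv⟩⟩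

/-- **Valuation chase, quadruple root, `v(Q) = 0`** (Stoll–Cremona, proof of Prop. A.3(3), with
Serf's remark on `6cI − J`): `v(a,b,c,d,e) ≥ (0,1,1,1,1)`, `v(a) = 0`, `v(I) ≥ 4`, `v(J) ≥ 6` give
`v(c) ≥ 2`, `v(d) ≥ 3`, `v(e) ≥ 4`. [cite: StollCremona2002, Prop. A.3 (proof of part 3)] -/
theorem chase_quadruple₀ (hP : Prime P) (h2 : ¬ P ∣ 2) (h3 : ¬ P ∣ 3) {a b c d e : ℤ}
    (ha : ¬ P ∣ a) (hb : P ∣ b) (hc : P ∣ c) (hd : P ∣ d) (he : P ∣ e)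
    (hI : P ^ 4 ∣ 12 * a * e - 3 * b * d + c ^ 2)
    (hJ : P ^ 6 ∣ 72 * a * c * e + 9 * b * c * d - 27 * a * d ^ 2 - 27 * e * b ^ 2 - 2 * c ^ 3) :
    P ^ 2 ∣ c ∧ P ^ 3 ∣ d ∧ P ^ 4 ∣ e := by
  obtain ⟨-, h8, h12, h27⟩ := not_dvd_consts hP h2 h3
  have h12a : ¬ P ∣ 12 * a := fun h ↦ (hP.dvd_mul.mp h).elim h12 ha
  have h27a : ¬ P ∣ 27 * a := fun h ↦ (hP.dvd_mul.mp h).elim h27 ha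
  set Iₑ := 12 * a * e - 3 * b * d + c ^ 2 with hIₑ
  set Jₑ := 72 * a * c * e + 9 * b * c * d - 27 * a * d ^ 2 - 27 * e * b ^ 2 - 2 * c ^ 3 with hJₑ
  have eI : 12 * a * e = Iₑ + 3 * b * d + (-1) * c ^ 2 := by rw [hIₑ]; ring
  have eJ : 27 * a * d ^ 2 =
      72 * a * c * e + 9 * b * c * d + (-27) * e * b ^ 2 + (-2) * c ^ 3 + (-1) * Jₑ := by
    rw [hJₑ]; ring
  have eC : 8 * c ^ 3 =
      6 * c * Iₑ + (-1) * Jₑ + 27 * b * c * d + (-27) * a * d ^ 2 + (-27) * e * b ^ 2 := by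
    rw [hIₑ, hJₑ]; ring
  have hb1 : P ^ 1 ∣ b := by rwa [pow_one]
  have hc1 : P ^ 1 ∣ c := by rwa [pow_one]
  have hd1 : P ^ 1 ∣ d := by rwa [pow_one]
  have he1 : P ^ 1 ∣ e := by rwa [pow_one]
  -- step 1: `v(e) ≥ 2`
  have he2 : P ^ 2 ∣ e := by
    refine hP.pow_dvd_of_dvd_mul_left 2 h12a ?_
    rw [eI]
    refine dvd_add (dvd_add (pow_dvd_of_le hI (by norm_num)) ?_) ?_
    · simpa using pow_dvd_mul₂ hb1 hd1 3
    · simpa using (pow_dvd_sq_of_dvd hc1).mul_left (-1)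
  -- step 2: `v(d) ≥ 2`
  have hd2 : P ^ 2 ∣ d := by
    refine pow_dvd_of_sq_odd hP (k := 1) (hP.pow_dvd_of_dvd_mul_left 3 h27a ?_)
    rw [eJ]
    refine dvd_add (dvd_add (dvd_add (dvd_add ?_ ?_) ?_) ?_) (pow_dvd_of_le (hJ.mul_left _) (by norm_num))
    · simpa using pow_dvd_mul₂ hc1 he2 (72 * a)
    · simpa using pow_dvd_mul₃ hb1 hc1 hd1 9
    · exact pow_dvd_of_le (by simpa using pow_dvd_mul₂ he2 (pow_dvd_sq_of_dvd hb1) (-27)) (by norm_num)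
    · simpa using (pow_dvd_cube_of_dvd hc1).mul_left (-2)
  -- step 3: `v(c) ≥ 2` (Serf)
  have hc2 : P ^ 2 ∣ c := by
    refine sq_dvd_of_pow_four_dvd_cube hP (hP.pow_dvd_of_dvd_mul_left 4 h8 ?_)
    rw [show (8 : ℤ) * c ^ 3 = 8 * c ^ 3 from rfl, eC]
    refine dvd_add (dvd_add (dvd_add (dvd_add ?_ ?_) ?_) ?_) ?_
    · exact pow_dvd_of_le (by simpa using pow_dvd_mul₂ hc1 hI 6) (by norm_num)
    · exact pow_dvd_of_le (hJ.mul_left _) (by norm_num)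
    · simpa using pow_dvd_mul₃ hb1 hc1 hd2 27
    · simpa using (pow_dvd_sq_of_dvd hd2).mul_left (-27 * a)
    · simpa using pow_dvd_mul₂ he2 (pow_dvd_sq_of_dvd hb1) (-27)
  -- step 4: `v(e) ≥ 3`
  have he3 : P ^ 3 ∣ e := by
    refine hP.pow_dvd_of_dvd_mul_left 3 h12a ?_
    rw [eI]
    refine dvd_add (dvd_add (pow_dvd_of_le hI (by norm_num)) ?_) ?_
    · simpa using pow_dvd_mul₂ hb1 hd2 3
    · exact pow_dvd_of_le (by simpa using (pow_dvd_sq_of_dvd hc2).mul_left (-1)) (by norm_num)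
  -- step 5: `v(d) ≥ 3`
  have hd3 : P ^ 3 ∣ d := by
    refine pow_dvd_of_sq_odd hP (k := 2) (hP.pow_dvd_of_dvd_mul_left 5 h27a ?_)
    rw [eJ]
    refine dvd_add (dvd_add (dvd_add (dvd_add ?_ ?_) ?_) ?_) (pow_dvd_of_le (hJ.mul_left _) (by norm_num))
    · simpa using pow_dvd_mul₂ hc2 he3 (72 * a)
    · simpa using pow_dvd_mul₃ hb1 hc2 hd2 9
    · simpa using pow_dvd_mul₂ he3 (pow_dvd_sq_of_dvd hb1) (-27)
    · exact pow_dvd_of_le (by simpa using (pow_dvd_cube_of_dvd hc2).mul_left (-2)) (by norm_num)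
  -- step 6: `v(e) ≥ 4`
  have he4 : P ^ 4 ∣ e := by
    refine hP.pow_dvd_of_dvd_mul_left 4 h12a ?_
    rw [eI]
    refine dvd_add (dvd_add hI ?_) ?_
    · simpa using pow_dvd_mul₂ hb1 hd3 3
    · simpa using (pow_dvd_sq_of_dvd hc2).mul_left (-1)
  exact ⟨hc2, hd3, he4⟩

/-- **Valuation chase, triple root, `v(Q) = 0`** (Stoll–Cremona, proof of Lemma A.2, case
`v(Q) = 0`): `v(a,b,c,d,e) ≥ (1,0,2,1,1)`, `v(b) = 0`, `v(I) ≥ 4`, `v(J) ≥ 6` give `v(d) ≥ 4`,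
`v(e) ≥ 6`. [cite: StollCremona2002, Lemma A.2 (proof)] -/
theorem chase_triple₀ (hP : Prime P) (h2 : ¬ P ∣ 2) (h3 : ¬ P ∣ 3) {a b c d e : ℤ}
    (ha : P ∣ a) (hb : ¬ P ∣ b) (hc : P ^ 2 ∣ c) (hd : P ∣ d) (he : P ∣ e)
    (hI : P ^ 4 ∣ 12 * a * e - 3 * b * d + c ^ 2)
    (hJ : P ^ 6 ∣ 72 * a * c * e + 9 * b * c * d - 27 * a * d ^ 2 - 27 * e * b ^ 2 - 2 * c ^ 3) :
    P ^ 4 ∣ d ∧ P ^ 6 ∣ e := by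
  obtain ⟨-, -, -, h27⟩ := not_dvd_consts hP h2 h3
  have h3b : ¬ P ∣ 3 * b := fun h ↦ (hP.dvd_mul.mp h).elim h3 hb
  have h27b : ¬ P ∣ 27 * b ^ 2 := fun h ↦
    (hP.dvd_mul.mp h).elim h27 (fun h' ↦ hb (hP.dvd_of_dvd_pow h'))
  set Iₑ := 12 * a * e - 3 * b * d + c ^ 2 with hIₑ
  set Jₑ := 72 * a * c * e + 9 * b * c * d - 27 * a * d ^ 2 - 27 * e * b ^ 2 - 2 * c ^ 3 with hJₑ
  have eI : 3 * b * d = 12 * a * e + c ^ 2 + (-1) * Iₑ := by rw [hIₑ]; ring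
  have eJ : 27 * b ^ 2 * e =
      72 * a * c * e + 9 * b * c * d + (-27 * a) * d ^ 2 + (-2) * c ^ 3 + (-1) * Jₑ := by
    rw [hJₑ]; ring
  have ha1 : P ^ 1 ∣ a := by rwa [pow_one]
  have hd1 : P ^ 1 ∣ d := by rwa [pow_one]
  have he1 : P ^ 1 ∣ e := by rwa [pow_one]
  -- `v(d) ≥ 2`
  have hd2 : P ^ 2 ∣ d := by
    refine hP.pow_dvd_of_dvd_mul_left 2 h3b ?_
    rw [eI]
    refine dvd_add (dvd_add ?_ ?_) (pow_dvd_of_le (hI.mul_left _) (by norm_num))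
    · simpa using pow_dvd_mul₂ ha1 he1 12
    · exact pow_dvd_of_le (by simpa using pow_dvd_sq_of_dvd hc) (by norm_num)
  -- `v(e) ≥ 4`
  have he4 : P ^ 4 ∣ e := by
    refine hP.pow_dvd_of_dvd_mul_left 4 h27b ?_
    rw [eJ]
    refine dvd_add (dvd_add (dvd_add (dvd_add ?_ ?_) ?_) ?_) (pow_dvd_of_le (hJ.mul_left _) (by norm_num))
    · simpa using pow_dvd_mul₃ ha1 hc he1 72
    · simpa using pow_dvd_mul₂ hc hd2 (9 * b)
    · exact pow_dvd_of_le (by simpa using pow_dvd_mul₂ ha1 (pow_dvd_sq_of_dvd hd2) (-27)) (by norm_num)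
    · exact pow_dvd_of_le (by simpa using (pow_dvd_cube_of_dvd hc).mul_left (-2)) (by norm_num)
  -- `v(d) ≥ 4`
  have hd4 : P ^ 4 ∣ d := by
    refine hP.pow_dvd_of_dvd_mul_left 4 h3b ?_
    rw [eI]
    refine dvd_add (dvd_add ?_ ?_) (hI.mul_left _)
    · exact pow_dvd_of_le (by simpa using pow_dvd_mul₂ ha1 he4 12) (by norm_num)
    · simpa using pow_dvd_sq_of_dvd hc
  -- `v(e) ≥ 6`
  have he6 : P ^ 6 ∣ e := by
    refine hP.pow_dvd_of_dvd_mul_left 6 h27b ?_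
    rw [eJ]
    refine dvd_add (dvd_add (dvd_add (dvd_add ?_ ?_) ?_) ?_) (hJ.mul_left _)
    · exact pow_dvd_of_le (by simpa using pow_dvd_mul₃ ha1 hc he4 72) (by norm_num)
    · simpa using pow_dvd_mul₂ hc hd4 (9 * b)
    · exact pow_dvd_of_le (by simpa using pow_dvd_mul₂ ha1 (pow_dvd_sq_of_dvd hd4) (-27)) (by norm_num)
    · simpa using (pow_dvd_cube_of_dvd hc).mul_left (-2)
  exact ⟨hd4, he6⟩

/-- **Valuation chase, quadruple root, `v(Q) = 1`** (Stoll–Cremona, proof of Prop. A.3(4)):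
`v(a,b,c,d,e) ≥ (1,2,2,2,2)`, `v(a) = 1`, `v(I) ≥ 4`, `v(J) ≥ 6` give `v(d) ≥ 3`, `v(e) ≥ 3`.
[cite: StollCremona2002, Prop. A.3 (proof of part 4)] -/
theorem chase_quadruple₁ (hP : Prime P) (h2 : ¬ P ∣ 2) (h3 : ¬ P ∣ 3) {a a₀ b c d e : ℤ}
    (ha : a = P * a₀) (ha₀ : ¬ P ∣ a₀) (hb : P ^ 2 ∣ b) (hc : P ^ 2 ∣ c) (hd : P ^ 2 ∣ d)
    (_he : P ^ 2 ∣ e) (hI : P ^ 4 ∣ 12 * a * e - 3 * b * d + c ^ 2)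
    (hJ : P ^ 6 ∣ 72 * a * c * e + 9 * b * c * d - 27 * a * d ^ 2 - 27 * e * b ^ 2 - 2 * c ^ 3) :
    P ^ 3 ∣ d ∧ P ^ 3 ∣ e := by
  obtain ⟨-, -, h12, h27⟩ := not_dvd_consts hP h2 h3
  have hP0 : P ≠ 0 := hP.ne_zero
  have h12a : ¬ P ∣ 12 * a₀ := fun h ↦ (hP.dvd_mul.mp h).elim h12 ha₀
  have h27a : ¬ P ∣ 27 * a₀ := fun h ↦ (hP.dvd_mul.mp h).elim h27 ha₀
  set Iₑ := 12 * a * e - 3 * b * d + c ^ 2 with hIₑ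
  set Jₑ := 72 * a * c * e + 9 * b * c * d - 27 * a * d ^ 2 - 27 * e * b ^ 2 - 2 * c ^ 3 with hJₑ
  have eI : P * (12 * a₀ * e) = Iₑ + 3 * b * d + (-1) * c ^ 2 := by rw [hIₑ, ha]; ring
  have eJ : P * (27 * a₀ * d ^ 2) =
      72 * a * c * e + 9 * b * c * d + (-27) * e * b ^ 2 + (-2) * c ^ 3 + (-1) * Jₑ := by
    rw [hJₑ, ha]; ring
  have ha1 : P ^ 1 ∣ a := by rw [pow_one, ha]; exact dvd_mul_right P a₀
  -- `v(e) ≥ 3`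
  have he3 : P ^ 3 ∣ e := by
    refine hP.pow_dvd_of_dvd_mul_left 3 h12a ?_
    have h4 : P ^ 4 ∣ P * (12 * a₀ * e) := by
      rw [eI]
      refine dvd_add (dvd_add hI ?_) ?_
      · simpa using pow_dvd_mul₂ hb hd 3
      · simpa using (pow_dvd_sq_of_dvd hc).mul_left (-1)
    rw [show (4 : ℕ) = 3 + 1 from rfl, pow_succ, mul_comm (P ^ 3)] at h4
    exact (mul_dvd_mul_iff_left hP0).mp h4
  -- `v(d) ≥ 3`
  have hd3 : P ^ 3 ∣ d := by
    refine pow_dvd_of_sq_odd hP (k := 2) (hP.pow_dvd_of_dvd_mul_left 5 h27a ?_)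
    have h6 : P ^ 6 ∣ P * (27 * a₀ * d ^ 2) := by
      rw [eJ]
      refine dvd_add (dvd_add (dvd_add (dvd_add ?_ ?_) ?_) ?_) (hJ.mul_left _)
      · simpa using pow_dvd_mul₃ ha1 hc he3 72
      · simpa using pow_dvd_mul₃ hb hc hd 9
      · exact pow_dvd_of_le (by simpa using pow_dvd_mul₂ he3 (pow_dvd_sq_of_dvd hb) (-27)) (by norm_num)
      · simpa using (pow_dvd_cube_of_dvd hc).mul_left (-2)
    rw [show (6 : ℕ) = 5 + 1 from rfl, pow_succ, mul_comm (P ^ 5)] at h6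
    exact (mul_dvd_mul_iff_left hP0).mp h6
  exact ⟨hd3, he3⟩

/-- **Valuation chase, triple root, `v(Q) = 1`** (Stoll–Cremona, proof of Lemma A.2, case
`v(Q) = 1`, applied to `Q₁ = Q/p`): `v(a,b,c,d,e) ≥ (1,0,2,1,1)`, `v(b) = 0`, `v(I₁) ≥ 2`,
`v(J₁) ≥ 3` give `v(d) ≥ 2`, `v(e) ≥ 3`. [cite: StollCremona2002, Lemma A.2 (proof)] -/
theorem chase_triple₁ (hP : Prime P) (h2 : ¬ P ∣ 2) (h3 : ¬ P ∣ 3) {a b c d e : ℤ}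
    (ha : P ∣ a) (hb : ¬ P ∣ b) (hc : P ^ 2 ∣ c) (hd : P ∣ d) (he : P ∣ e)
    (hI : P ^ 2 ∣ 12 * a * e - 3 * b * d + c ^ 2)
    (hJ : P ^ 3 ∣ 72 * a * c * e + 9 * b * c * d - 27 * a * d ^ 2 - 27 * e * b ^ 2 - 2 * c ^ 3) :
    P ^ 2 ∣ d ∧ P ^ 3 ∣ e := by
  obtain ⟨-, -, -, h27⟩ := not_dvd_consts hP h2 h3
  have h3b : ¬ P ∣ 3 * b := fun h ↦ (hP.dvd_mul.mp h).elim h3 hb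
  have h27b : ¬ P ∣ 27 * b ^ 2 := fun h ↦
    (hP.dvd_mul.mp h).elim h27 (fun h' ↦ hb (hP.dvd_of_dvd_pow h'))
  set Iₑ := 12 * a * e - 3 * b * d + c ^ 2 with hIₑ
  set Jₑ := 72 * a * c * e + 9 * b * c * d - 27 * a * d ^ 2 - 27 * e * b ^ 2 - 2 * c ^ 3 with hJₑ
  have eI : 3 * b * d = 12 * a * e + c ^ 2 + (-1) * Iₑ := by rw [hIₑ]; ring
  have eJ : 27 * b ^ 2 * e =
      72 * a * c * e + 9 * b * c * d + (-27 * a) * d ^ 2 + (-2) * c ^ 3 + (-1) * Jₑ := by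
    rw [hJₑ]; ring
  have ha1 : P ^ 1 ∣ a := by rwa [pow_one]
  have hd1 : P ^ 1 ∣ d := by rwa [pow_one]
  have he1 : P ^ 1 ∣ e := by rwa [pow_one]
  have hd2 : P ^ 2 ∣ d := by
    refine hP.pow_dvd_of_dvd_mul_left 2 h3b ?_
    rw [eI]
    refine dvd_add (dvd_add ?_ ?_) (hI.mul_left _)
    · simpa using pow_dvd_mul₂ ha1 he1 12
    · exact pow_dvd_of_le (by simpa using pow_dvd_sq_of_dvd hc) (by norm_num)
  have he3 : P ^ 3 ∣ e := by
    refine hP.pow_dvd_of_dvd_mul_left 3 h27b ?_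
    rw [eJ]
    refine dvd_add (dvd_add (dvd_add (dvd_add ?_ ?_) ?_) ?_) (hJ.mul_left _)
    · exact pow_dvd_of_le (by simpa using pow_dvd_mul₃ ha1 hc he1 72) (by norm_num)
    · exact pow_dvd_of_le (by simpa using pow_dvd_mul₂ hc hd2 (9 * b)) (by norm_num)
    · exact pow_dvd_of_le (by simpa using pow_dvd_mul₂ ha1 (pow_dvd_sq_of_dvd hd2) (-27)) (by norm_num)
    · exact pow_dvd_of_le (by simpa using (pow_dvd_cube_of_dvd hc).mul_left (-2)) (by norm_num)
  exact ⟨hd2, he3⟩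

end Dvd



/-! ## §C The multiple root modulo `p`: normal forms over a field of characteristic `∤ 6` -/

section NormalForm

variable {F : Type*} [Field F]

/-- **Normal form, leading coefficient nonzero.** Over a field with `2, 3 ≠ 0`, a binary quartic
form with `a ≠ 0` and `I = J = 0` is brought by shears to `a x⁴` (quadruple root at `0`) or to
`b x³ y` (triple root at `0`, simple root at `∞`): depress (`4ar + b = 0`); then `I = J = 0` force
either `c = d = e = 0`, or `c ≠ 0` and `f = a (x − ρ y)³ (x + 3ρ y)` with `4cρ + 3d = 0`
(Stoll–Cremona, proof of Lemma A.2: "the vanishing of `I₁` and `J₁` mod `π` implies that `Q₁`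
has a root of multiplicity at least three"; made explicit and rational here).
[cite: StollCremona2002, Lemma A.2 (proof)] -/
theorem normalForm_of_a_ne_zero (h2 : (2 : F) ≠ 0) (h3 : (3 : F) ≠ 0) (g : BinaryQuartic F)
    (ha : g.a ≠ 0) (hI : g.I = 0) (hJ : g.J = 0) :
    ∃ (r s t : F) (h : BinaryQuartic F),
      g.subst (!![1, t; 0, 1] * !![1, 0; s, 1] * !![1, 0; r, 1]) = h ∧
      ((h.b = 0 ∧ h.c = 0 ∧ h.d = 0 ∧ h.e = 0 ∧ h.a ≠ 0) ∨
        (h.a = 0 ∧ h.c = 0 ∧ h.d = 0 ∧ h.e = 0 ∧ h.b ≠ 0)) := by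
  have h4 : (4 : F) ≠ 0 := by
    have := mul_ne_zero h2 h2; norm_num at this; exact this
  have h8 : (8 : F) ≠ 0 := by
    have := mul_ne_zero (mul_ne_zero h2 h2) h2; norm_num at this; exact this
  have h12 : (12 : F) ≠ 0 := by
    have := mul_ne_zero (mul_ne_zero h2 h2) h3; norm_num at this; exact this
  have h27 : (27 : F) ≠ 0 := by
    have := mul_ne_zero (mul_ne_zero h3 h3) h3; norm_num at this; exact this
  obtain ⟨a, b, c, d, e⟩ := g
  simp only at ha
  simp only [I] at hI
  simp only [J] at hJ
  -- depress: `r` with `4 a r + b = 0`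
  obtain ⟨r, hr⟩ : ∃ r : F, 4 * a * r + b = 0 := ⟨-b / (4 * a), by field_simp; ring⟩
  obtain ⟨c₁, d₁, e₁, hg₁⟩ : ∃ c₁ d₁ e₁ : F,
      (⟨a, b, c, d, e⟩ : BinaryQuartic F).subst !![1, 0; r, 1] = ⟨a, 0, c₁, d₁, e₁⟩ := by
    refine ⟨6 * a * r ^ 2 + 3 * b * r + c, 4 * a * r ^ 3 + 3 * b * r ^ 2 + 2 * c * r + d,
      a * r ^ 4 + b * r ^ 3 + c * r ^ 2 + d * r + e, ?_⟩
    rw [subst_lowerShear]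
    ext
    · rfl
    · exact hr
    · rfl
    · rfl
    · rfl
  -- invariants of the depressed form (invariance of `I`, `J` under the shear, `det = 1`)
  have hI₁ : 12 * a * e₁ + c₁ ^ 2 = 0 := by
    have key := I_subst (⟨a, b, c, d, e⟩ : BinaryQuartic F) !![1, 0; r, 1]
    rw [hg₁, det_lowerShear] at key
    simp only [I] at key
    linear_combination key + hI
  have hJ₁ : 72 * a * c₁ * e₁ - 27 * a * d₁ ^ 2 - 2 * c₁ ^ 3 = 0 := by
    have key := J_subst (⟨a, b, c, d, e⟩ : BinaryQuartic F) !![1, 0; r, 1]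
    rw [hg₁, det_lowerShear] at key
    simp only [J] at key
    linear_combination key + hJ
  by_cases hc0 : c₁ = 0
  · -- quadruple root at `0`: `c₁ = d₁ = e₁ = 0`
    have he0 : e₁ = 0 := by
      have h : 12 * a * e₁ = 0 := by rw [hc0] at hI₁; linear_combination hI₁
      rcases mul_eq_zero.mp h with h | h
      · exact absurd h (mul_ne_zero h12 ha)
      · exact h
    have hd0 : d₁ = 0 := by
      have h : -27 * a * d₁ ^ 2 = 0 := by rw [hc0, he0] at hJ₁; linear_combination hJ₁
      rcases mul_eq_zero.mp h with h | h
      · exact absurd h (mul_ne_zero (neg_ne_zero.mpr h27) ha)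
      · exact pow_eq_zero_iff two_ne_zero |>.mp h
    refine ⟨r, 0, 0, ⟨a, 0, c₁, d₁, e₁⟩, ?_, Or.inl ⟨rfl, hc0, hd0, he0, ha⟩⟩
    rw [← Matrix.one_fin_two, one_mul, one_mul, hg₁]
  · -- triple root: `f = a (x - ρ y)³ (x + 3 ρ y)` with `4 c₁ ρ + 3 d₁ = 0`
    obtain ⟨ρ, hρ⟩ : ∃ ρ : F, 4 * c₁ * ρ + 3 * d₁ = 0 :=
      ⟨-3 * d₁ / (4 * c₁), by field_simp; ring⟩
    have hcρ : c₁ = -6 * a * ρ ^ 2 := by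
      have key : -8 * (c₁ ^ 2 * (c₁ + 6 * a * ρ ^ 2)) = 0 := by
        linear_combination hJ₁ - 6 * c₁ * hI₁ + 3 * a * (3 * d₁ - 4 * c₁ * ρ) * hρ
      rcases mul_eq_zero.mp key with h | h
      · exact absurd h (neg_ne_zero.mpr h8)
      · rcases mul_eq_zero.mp h with h | h
        · exact absurd (pow_eq_zero_iff two_ne_zero |>.mp h) hc0
        · linear_combination h
    have hdρ : d₁ = 8 * a * ρ ^ 3 := by
      have key : 3 * (d₁ - 8 * a * ρ ^ 3) = 0 := by linear_combination hρ - 4 * ρ * hcρ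
      rcases mul_eq_zero.mp key with h | h
      · exact absurd h h3
      · linear_combination h
    have heρ : e₁ = -3 * a * ρ ^ 4 := by
      have key : 12 * a * (e₁ + 3 * a * ρ ^ 4) = 0 := by
        linear_combination hI₁ - (c₁ - 6 * a * ρ ^ 2) * hcρ
      rcases mul_eq_zero.mp key with h | h
      · exact absurd h (mul_ne_zero h12 ha)
      · linear_combination h
    have hρ0 : ρ ≠ 0 := by
      rintro rfl
      apply hc0
      rw [hcρ]; ring
    -- move the triple root to `0` …
    have hg₂ : (⟨a, 0, c₁, d₁, e₁⟩ : BinaryQuartic F).subst !![1, 0; ρ, 1] =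
        ⟨a, 4 * a * ρ, 0, 0, 0⟩ := by
      rw [subst_lowerShear]
      ext
      · rfl
      · show 4 * a * ρ + 0 = 4 * a * ρ
        ring
      · show 6 * a * ρ ^ 2 + 3 * 0 * ρ + c₁ = 0
        linear_combination hcρ
      · show 4 * a * ρ ^ 3 + 3 * 0 * ρ ^ 2 + 2 * c₁ * ρ + d₁ = 0
        linear_combination 2 * ρ * hcρ + hdρ
      · show a * ρ ^ 4 + 0 * ρ ^ 3 + c₁ * ρ ^ 2 + d₁ * ρ + e₁ = 0
        linear_combination ρ ^ 2 * hcρ + ρ * hdρ + heρ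
    -- … and the simple root to `∞`
    obtain ⟨t, ht⟩ : ∃ t : F, 4 * ρ * t + 1 = 0 := ⟨-1 / (4 * ρ), by field_simp; ring⟩
    have hg₃ : (⟨a, 4 * a * ρ, 0, 0, 0⟩ : BinaryQuartic F).subst !![1, t; 0, 1] =
        ⟨0, 4 * a * ρ, 0, 0, 0⟩ := by
      rw [subst_upperShear]
      ext
      · show a + 4 * a * ρ * t + 0 * t ^ 2 + 0 * t ^ 3 + 0 * t ^ 4 = 0
        linear_combination a * ht
      · show 4 * a * ρ + 2 * 0 * t + 3 * 0 * t ^ 2 + 4 * 0 * t ^ 3 = 4 * a * ρ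
        ring
      · show (0 : F) + 3 * 0 * t + 6 * 0 * t ^ 2 = 0
        ring
      · show (0 : F) + 4 * 0 * t = 0
        ring
      · rfl
    refine ⟨r, ρ, t, ⟨0, 4 * a * ρ, 0, 0, 0⟩, ?_, Or.inr ⟨rfl, rfl, rfl, rfl, ?_⟩⟩
    · rw [subst_mul, subst_mul, hg₁, hg₂, hg₃]
    · exact mul_ne_zero (mul_ne_zero h4 ha) hρ0

/-- **Normal form.** Over a field with `2, 3 ≠ 0`, a nonzero binary quartic form with
`I = J = 0` has a root of multiplicity `≥ 3` defined over the field, and a product `M` of shears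
and the rotation `(x, y) ↦ (-y, x)` brings it to `a x⁴` (`a ≠ 0`) or `b x³ y` (`b ≠ 0`)
(Stoll–Cremona, Lemma A.2 and the normalisations in the proofs of Lemma A.2, Prop. A.3: "we can
achieve a situation where the triple root is at zero (mod `π`), and where the remaining root is at
infinity"). [cite: StollCremona2002, Lemma A.2 (proof)] -/
theorem normalForm (h2 : (2 : F) ≠ 0) (h3 : (3 : F) ≠ 0) (g : BinaryQuartic F)
    (hg : g.a ≠ 0 ∨ g.b ≠ 0 ∨ g.c ≠ 0 ∨ g.d ≠ 0 ∨ g.e ≠ 0) (hI : g.I = 0) (hJ : g.J = 0) :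
    ∃ (r s t : F) (ε : ℕ) (h : BinaryQuartic F),
      g.subst (!![1, t; 0, 1] * !![1, 0; s, 1] * !![1, 0; r, 1] * !![0, 1; -1, 0] ^ ε) = h ∧
      ((h.b = 0 ∧ h.c = 0 ∧ h.d = 0 ∧ h.e = 0 ∧ h.a ≠ 0) ∨
        (h.a = 0 ∧ h.c = 0 ∧ h.d = 0 ∧ h.e = 0 ∧ h.b ≠ 0)) := by
  by_cases ha : g.a ≠ 0
  · obtain ⟨r, s, t, h, hh, hshape⟩ := normalForm_of_a_ne_zero h2 h3 g ha hI hJ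
    exact ⟨r, s, t, 0, h, by rw [pow_zero, mul_one, hh], hshape⟩
  rw [not_ne_iff] at ha
  by_cases he : g.e ≠ 0
  · -- root at `0 = (0 : 1)`… rotate so that the leading coefficient is `e ≠ 0`
    set g' := g.subst !![0, 1; -1, 0] with hg'
    have ha' : g'.a ≠ 0 := by rw [hg', subst_swap]; exact he
    have hI' : g'.I = 0 := by rw [hg', I_subst, det_swap, hI, mul_zero]
    have hJ' : g'.J = 0 := by rw [hg', J_subst, det_swap, hJ, mul_zero]
    obtain ⟨r, s, t, h, hh, hshape⟩ := normalForm_of_a_ne_zero h2 h3 g' ha' hI' hJ'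
    refine ⟨r, s, t, 1, h, ?_, hshape⟩
    rw [pow_one, subst_mul, ← hg', hh]
  rw [not_ne_iff] at he
  -- `a = e = 0`: `I = -3bd + c²`, `J = 9bcd - 2c³`
  obtain ⟨a, b, c, d, e⟩ := g
  simp only at ha he hg
  subst ha he
  simp only [I] at hI
  simp only [J] at hJ
  have hc : c = 0 := by
    by_contra hc
    have key : c ^ 2 * c = 0 := by linear_combination hJ + 3 * c * hI
    rcases mul_eq_zero.mp key with h | h
    · exact hc (pow_eq_zero_iff two_ne_zero |>.mp h)
    · exact hc h
  subst hc
  have hbd : 3 * b * d = 0 := by linear_combination (-1 : F) * hI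
  by_cases hd : d = 0
  · subst hd
    have hb : b ≠ 0 := by
      rintro rfl; simp at hg
    refine ⟨0, 0, 0, 0, ⟨0, b, 0, 0, 0⟩, ?_, Or.inr ⟨rfl, rfl, rfl, rfl, hb⟩⟩
    rw [pow_zero, mul_one, ← Matrix.one_fin_two, one_mul, one_mul, subst_one]
  · have hb : b = 0 := by
      rcases mul_eq_zero.mp hbd with h | h
      · rcases mul_eq_zero.mp h with h | h
        · exact absurd h h3
        · exact h
      · exact absurd h hd
    subst hb
    refine ⟨0, 0, 0, 1, ⟨0, -d, 0, 0, 0⟩, ?_, Or.inr ⟨rfl, rfl, rfl, rfl, neg_ne_zero.mpr hd⟩⟩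
    rw [pow_one, ← Matrix.one_fin_two, one_mul, one_mul, one_mul, subst_swap]
    ext <;> simp

end NormalForm

/-! ## Lifting the normalising matrix to `SL₂(ℤ)` -/

section Lift

/-- Casting a `2 × 2` matrix entrywise. [folklore] -/
theorem map_fin_two {R S : Type*} (φ : R → S) (a b c d : R) :
    (!![a, b; c, d] : Matrix (Fin 2) (Fin 2) R).map φ = !![φ a, φ b; φ c, φ d] := by
  ext i j; fin_cases i <;> fin_cases j <;> rfl

/-- **The multiple root modulo `p`, integrally.** For `p ≥ 5` and an integral form `f` that is
nonzero modulo `p` with `p ∣ I(f)`, `p ∣ J(f)`, there is `M ∈ SL₂(ℤ)` such that `f · M` is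
congruent modulo `p` to `a x⁴` with `p ∤ a`, or to `b x³ y` with `p ∤ b` (Stoll–Cremona, proofs
of Lemma A.2 and Prop. A.3: "by a suitable transformation in `SL(2, 𝓞)` […] the triple root is
at zero (mod `π`), and […] the remaining root is at infinity"). [cite: StollCremona2002, Lemma A.2 (proof)] -/
theorem exists_sl2_shape {p : ℕ} [hp : Fact p.Prime] (hp5 : 5 ≤ p) (f : BinaryQuartic ℤ)
    (hf : ¬ ((p : ℤ) ∣ f.a ∧ (p : ℤ) ∣ f.b ∧ (p : ℤ) ∣ f.c ∧ (p : ℤ) ∣ f.d ∧ (p : ℤ) ∣ f.e))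
    (hI : (p : ℤ) ∣ f.I) (hJ : (p : ℤ) ∣ f.J) :
    ∃ M : Matrix (Fin 2) (Fin 2) ℤ, M.det = 1 ∧
      ((¬ (p : ℤ) ∣ (f.subst M).a ∧ (p : ℤ) ∣ (f.subst M).b ∧ (p : ℤ) ∣ (f.subst M).c ∧
          (p : ℤ) ∣ (f.subst M).d ∧ (p : ℤ) ∣ (f.subst M).e) ∨
        ((p : ℤ) ∣ (f.subst M).a ∧ ¬ (p : ℤ) ∣ (f.subst M).b ∧ (p : ℤ) ∣ (f.subst M).c ∧
          (p : ℤ) ∣ (f.subst M).d ∧ (p : ℤ) ∣ (f.subst M).e)) := by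
  have hpp := hp.out
  -- `2, 3 ≠ 0` in `ZMod p`
  have hne : ∀ n : ℕ, 0 < n → n < 5 → ((n : ℤ) : ZMod p) ≠ 0 := by
    intro n hn0 hn5 h
    rw [Int.cast_natCast, ZMod.natCast_eq_zero_iff] at h
    exact absurd (Nat.le_of_dvd hn0 h) (by omega)
  have h2 : (2 : ZMod p) ≠ 0 := by exact_mod_cast hne 2 (by norm_num) (by norm_num)
  have h3 : (3 : ZMod p) ≠ 0 := by exact_mod_cast hne 3 (by norm_num) (by norm_num)
  set φ := Int.castRingHom (ZMod p) with hφ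
  have hdvd : ∀ z : ℤ, φ z = 0 ↔ (p : ℤ) ∣ z := fun z ↦ by
    rw [hφ, eq_intCast, ZMod.intCast_zmod_eq_zero_iff_dvd]
  set g := f.map φ with hg
  have hg0 : g.a ≠ 0 ∨ g.b ≠ 0 ∨ g.c ≠ 0 ∨ g.d ≠ 0 ∨ g.e ≠ 0 := by
    simp only [hg, map_a, map_b, map_c, map_d, map_e, ne_eq, hdvd]
    tauto
  have hgI : g.I = 0 := by rw [hg, I_map, hdvd]; exact hI
  have hgJ : g.J = 0 := by rw [hg, J_map, hdvd]; exact hJ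
  obtain ⟨r, s, t, ε, h, hh, hshape⟩ := normalForm h2 h3 g hg0 hgI hgJ
  -- integer lifts of the shears
  set M : Matrix (Fin 2) (Fin 2) ℤ :=
    !![1, (t.val : ℤ); 0, 1] * !![1, 0; (s.val : ℤ), 1] * !![1, 0; (r.val : ℤ), 1] *
      !![0, 1; -1, 0] ^ ε with hM
  have hMdet : M.det = 1 := by
    rw [hM, Matrix.det_mul, Matrix.det_mul, Matrix.det_mul, Matrix.det_pow, det_upperShear,
      det_lowerShear, det_lowerShear, det_swap]
    simp
  have hMmap : M.map φ =
      !![1, t; 0, 1] * !![1, 0; s, 1] * !![1, 0; r, 1] * !![0, 1; -1, 0] ^ ε := by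
    rw [← RingHom.mapMatrix_apply, hM, map_mul, map_mul, map_mul, map_pow]
    simp only [RingHom.mapMatrix_apply, map_fin_two]
    simp [hφ]
  have hsub : (f.subst M).map φ = h := by rw [map_subst, hMmap, ← hg, hh]
  have ca : (p : ℤ) ∣ (f.subst M).a ↔ h.a = 0 := by rw [← hdvd, ← map_a φ (f.subst M), hsub]
  have cb : (p : ℤ) ∣ (f.subst M).b ↔ h.b = 0 := by rw [← hdvd, ← map_b φ (f.subst M), hsub]
  have cc : (p : ℤ) ∣ (f.subst M).c ↔ h.c = 0 := by rw [← hdvd, ← map_c φ (f.subst M), hsub]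
  have cd : (p : ℤ) ∣ (f.subst M).d ↔ h.d = 0 := by rw [← hdvd, ← map_d φ (f.subst M), hsub]
  have ce : (p : ℤ) ∣ (f.subst M).e ↔ h.e = 0 := by rw [← hdvd, ← map_e φ (f.subst M), hsub]
  refine ⟨M, hMdet, ?_⟩
  rw [ca, cb, cc, cd, ce]
  rcases hshape with ⟨hb, hc, hd, he, ha⟩ | ⟨ha, hc, hd, he, hb⟩
  · exact Or.inl ⟨ha, hb, hc, hd, he⟩
  · exact Or.inr ⟨ha, hb, hc, hd, he⟩

end Lift

/-! ## `ℚ_p`-insolubility when `v(a,b,c,d,e) = (1, ≥2, ≥2, ≥3, 3)` -/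

section Insoluble

variable {p : ℕ} [hp : Fact p.Prime]

/-- Nonarchimedean bound for a sum. [folklore] -/
theorem norm_add_le_of_le' {C : ℝ} {u v : ℚ_[p]} (hu : ‖u‖ ≤ C) (hv : ‖v‖ ≤ C) :
    ‖u + v‖ ≤ C :=
  (Padic.nonarchimedean u v).trans (max_le hu hv)

/-- An integer prime to `p` is a `p`-adic unit. [folklore] -/
theorem norm_intCast_eq_one {k : ℤ} (hk : ¬ (p : ℤ) ∣ k) : ‖(k : ℚ_[p])‖ = 1 :=
  le_antisymm (Padic.norm_int_le_one k)
    (not_lt.mp (fun h ↦ hk (Padic.norm_intCast_lt_one_iff.mp h)))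

/-- `p^n ∣ k` bounds the `p`-adic norm of `k` by `p⁻ⁿ`. [folklore] -/
theorem norm_intCast_le_inv_pow {k : ℤ} {n : ℕ} (hk : (p : ℤ) ^ n ∣ k) :
    ‖(k : ℚ_[p])‖ ≤ ((p : ℝ)⁻¹) ^ n := by
  have := (Padic.norm_int_le_pow_iff_dvd k n).mpr hk
  rwa [inv_pow, ← zpow_natCast, ← zpow_neg]

/-- **The solubility step of Stoll–Cremona, Prop. A.3(4)**: if `v(a) = 1`, `v(b) ≥ 2`,
`v(c) ≥ 2`, `v(d) ≥ 3` and `v(e) = 3`, then "`v(Q(x, z))` is odd for all `(x, z) ≠ 0`", so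
`z² = Q(x, y)` has no solution over `ℚ_p`: for `|y| ≤ |x|` the term `a x⁴` dominates, for
`|x| < |y|` the term `e y⁴` does, and both have odd valuation while a square has even valuation.
[cite: StollCremona2002, Prop. A.3 (proof of part 4)] -/
theorem not_isSoluble_of_valuations (f : BinaryQuartic ℤ) {a₀ e₀ : ℤ} (ha : f.a = p * a₀)
    (ha₀ : ¬ (p : ℤ) ∣ a₀) (hb : (p : ℤ) ^ 2 ∣ f.b) (hc : (p : ℤ) ^ 2 ∣ f.c)
    (hd : (p : ℤ) ^ 3 ∣ f.d) (he : f.e = (p : ℤ) ^ 3 * e₀) (he₀ : ¬ (p : ℤ) ∣ e₀) :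
    ¬ (f.map (Int.castRingHom ℚ_[p])).IsSoluble := by
  rintro ⟨x, y, z, hxy, hz⟩
  obtain ⟨q, hq⟩ : ∃ q : ℝ, (p : ℝ)⁻¹ = q := ⟨_, rfl⟩
  have hp1 : (1 : ℝ) < p := by exact_mod_cast hp.out.one_lt
  have hp0 : (0 : ℝ) < p := by linarith
  have hq0 : 0 < q := by rw [← hq]; exact inv_pos.mpr hp0
  have hq1 : q < 1 := by rw [← hq]; exact inv_lt_one_of_one_lt₀ hp1
  have hq21 : q ^ 2 < q := by nlinarith
  have hq32 : q ^ 3 ≤ q ^ 2 := by nlinarith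
  have hq43 : q ^ 4 < q ^ 3 := by nlinarith [pow_pos hq0 2]
  have hq54 : q ^ 5 ≤ q ^ 4 := by nlinarith [pow_pos hq0 3]
  have hq3 : 0 < q ^ 3 := pow_pos hq0 3
  -- norms of the coefficients
  have nA : ‖(f.a : ℚ_[p])‖ = q := by
    rw [ha, Int.cast_mul, Int.cast_natCast, norm_mul, Padic.norm_p, norm_intCast_eq_one ha₀,
      mul_one, hq]
  have nB : ‖(f.b : ℚ_[p])‖ ≤ q ^ 2 := by rw [← hq]; exact norm_intCast_le_inv_pow hb
  have nC : ‖(f.c : ℚ_[p])‖ ≤ q ^ 2 := by rw [← hq]; exact norm_intCast_le_inv_pow hc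
  have nD : ‖(f.d : ℚ_[p])‖ ≤ q ^ 3 := by rw [← hq]; exact norm_intCast_le_inv_pow hd
  have nE : ‖(f.e : ℚ_[p])‖ = q ^ 3 := by
    rw [he, Int.cast_mul, Int.cast_pow, Int.cast_natCast, norm_mul, norm_pow, Padic.norm_p,
      norm_intCast_eq_one he₀, mul_one, hq]
  -- norms of nonzero elements are integral powers of `q`
  have hnorm : ∀ {w : ℚ_[p]}, w ≠ 0 → ‖w‖ = q ^ w.valuation := fun {w} hw ↦ by
    rw [Padic.norm_eq_zpow_neg_valuation hw, ← hq, inv_zpow']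
  have hinj : ∀ {m n : ℤ}, q ^ m = q ^ n → m = n := fun h ↦ zpow_right_injective₀ hq0 hq1.ne h
  -- the value of the form
  have hQ : (f.map (Int.castRingHom ℚ_[p])).eval x y =
      (f.a : ℚ_[p]) * x ^ 4 + (f.b : ℚ_[p]) * x ^ 3 * y + (f.c : ℚ_[p]) * x ^ 2 * y ^ 2 +
        (f.d : ℚ_[p]) * x * y ^ 3 + (f.e : ℚ_[p]) * y ^ 4 := by
    simp only [eval, map_a, map_b, map_c, map_d, map_e, eq_intCast]
  -- norms of the five terms
  have n1 : ‖(f.a : ℚ_[p]) * x ^ 4‖ = q * ‖x‖ ^ 4 := by rw [norm_mul, norm_pow, nA]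
  have n2 : ‖(f.b : ℚ_[p]) * x ^ 3 * y‖ ≤ q ^ 2 * ‖x‖ ^ 3 * ‖y‖ := by
    rw [norm_mul, norm_mul, norm_pow]
    exact mul_le_mul_of_nonneg_right (mul_le_mul_of_nonneg_right nB (pow_nonneg (norm_nonneg x) 3))
      (norm_nonneg y)
  have n3 : ‖(f.c : ℚ_[p]) * x ^ 2 * y ^ 2‖ ≤ q ^ 2 * ‖x‖ ^ 2 * ‖y‖ ^ 2 := by
    rw [norm_mul, norm_mul, norm_pow, norm_pow]
    exact mul_le_mul_of_nonneg_right (mul_le_mul_of_nonneg_right nC (pow_nonneg (norm_nonneg x) 2))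
      (pow_nonneg (norm_nonneg y) 2)
  have n4 : ‖(f.d : ℚ_[p]) * x * y ^ 3‖ ≤ q ^ 3 * ‖x‖ * ‖y‖ ^ 3 := by
    rw [norm_mul, norm_mul, norm_pow]
    exact mul_le_mul_of_nonneg_right (mul_le_mul_of_nonneg_right nD (norm_nonneg x))
      (pow_nonneg (norm_nonneg y) 3)
  have n5 : ‖(f.e : ℚ_[p]) * y ^ 4‖ = q ^ 3 * ‖y‖ ^ 4 := by rw [norm_mul, norm_pow, nE]
  rcases le_or_gt ‖y‖ ‖x‖ with hle | hlt
  · -- `|y| ≤ |x|`: the term `a x⁴` dominates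
    have hx0 : x ≠ 0 := by
      rintro rfl
      have hy : y = 0 := norm_le_zero_iff.mp (by simpa only [norm_zero] using hle)
      rcases hxy with h | h
      · exact h rfl
      · exact h hy
    have hXpos : 0 < ‖x‖ := norm_pos_iff.mpr hx0
    have hX4 : 0 < ‖x‖ ^ 4 := pow_pos hXpos 4
    have hrest : ‖(f.b : ℚ_[p]) * x ^ 3 * y + (f.c : ℚ_[p]) * x ^ 2 * y ^ 2 +
        (f.d : ℚ_[p]) * x * y ^ 3 + (f.e : ℚ_[p]) * y ^ 4‖ ≤ q ^ 2 * ‖x‖ ^ 4 := by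
      refine norm_add_le_of_le' (norm_add_le_of_le' (norm_add_le_of_le' (n2.trans ?_)
        (n3.trans ?_)) (n4.trans ?_)) (n5.le.trans ?_)
      · calc q ^ 2 * ‖x‖ ^ 3 * ‖y‖ ≤ q ^ 2 * ‖x‖ ^ 3 * ‖x‖ := by gcongr
          _ = q ^ 2 * ‖x‖ ^ 4 := by ring
      · calc q ^ 2 * ‖x‖ ^ 2 * ‖y‖ ^ 2 ≤ q ^ 2 * ‖x‖ ^ 2 * ‖x‖ ^ 2 := by gcongr
          _ = q ^ 2 * ‖x‖ ^ 4 := by ring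
      · calc q ^ 3 * ‖x‖ * ‖y‖ ^ 3 ≤ q ^ 3 * ‖x‖ * ‖x‖ ^ 3 :=
              mul_le_mul_of_nonneg_left (pow_le_pow_left₀ (norm_nonneg y) hle 3)
                (mul_nonneg hq3.le (norm_nonneg x))
          _ = q ^ 3 * ‖x‖ ^ 4 := by ring
          _ ≤ q ^ 2 * ‖x‖ ^ 4 := mul_le_mul_of_nonneg_right hq32 hX4.le
      · calc q ^ 3 * ‖y‖ ^ 4 ≤ q ^ 3 * ‖x‖ ^ 4 :=
              mul_le_mul_of_nonneg_left (pow_le_pow_left₀ (norm_nonneg y) hle 4) hq3.le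
          _ ≤ q ^ 2 * ‖x‖ ^ 4 := mul_le_mul_of_nonneg_right hq32 hX4.le
    have hmain_gt : ‖(f.b : ℚ_[p]) * x ^ 3 * y + (f.c : ℚ_[p]) * x ^ 2 * y ^ 2 +
        (f.d : ℚ_[p]) * x * y ^ 3 + (f.e : ℚ_[p]) * y ^ 4‖ < ‖(f.a : ℚ_[p]) * x ^ 4‖ := by
      rw [n1]
      exact hrest.trans_lt (mul_lt_mul_of_pos_right hq21 hX4)
    have hval : ‖(f.map (Int.castRingHom ℚ_[p])).eval x y‖ = q * ‖x‖ ^ 4 := by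
      rw [hQ, show (f.a : ℚ_[p]) * x ^ 4 + (f.b : ℚ_[p]) * x ^ 3 * y +
          (f.c : ℚ_[p]) * x ^ 2 * y ^ 2 + (f.d : ℚ_[p]) * x * y ^ 3 + (f.e : ℚ_[p]) * y ^ 4 =
          (f.a : ℚ_[p]) * x ^ 4 + ((f.b : ℚ_[p]) * x ^ 3 * y + (f.c : ℚ_[p]) * x ^ 2 * y ^ 2 +
          (f.d : ℚ_[p]) * x * y ^ 3 + (f.e : ℚ_[p]) * y ^ 4) by ring,
        Padic.add_eq_max_of_ne hmain_gt.ne', max_eq_left hmain_gt.le, n1]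
    have hz0 : z ≠ 0 := by
      rintro rfl
      have h0 : ‖(f.map (Int.castRingHom ℚ_[p])).eval x y‖ = 0 := by rw [← hz]; simp
      rw [hval] at h0
      exact (mul_pos hq0 hX4).ne' h0
    have key : q ^ (z.valuation * (2 : ℕ)) = q ^ (1 + x.valuation * (4 : ℕ)) := by
      have h1 : ‖z ^ 2‖ = q * ‖x‖ ^ 4 := by rw [hz, hval]
      rwa [norm_pow, hnorm hz0, hnorm hx0, ← zpow_natCast (q ^ z.valuation) 2, ← zpow_mul,
        ← zpow_natCast (q ^ x.valuation) 4, ← zpow_mul, ← zpow_one_add₀ hq0.ne'] at h1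
    have h2 := hinj key
    push_cast at h2
    omega
  · -- `|x| < |y|`: the term `e y⁴` dominates
    have hy0 : y ≠ 0 := by
      rintro rfl
      have : ‖x‖ < 0 := by simpa only [norm_zero] using hlt
      exact absurd this (not_lt.mpr (norm_nonneg x))
    have hYpos : 0 < ‖y‖ := norm_pos_iff.mpr hy0
    have hY4 : 0 < ‖y‖ ^ 4 := pow_pos hYpos 4
    -- `|x| ≤ q |y|`
    have hXt : ‖x‖ ≤ q * ‖y‖ := by
      by_cases hx0 : x = 0
      · rw [hx0, norm_zero]; exact mul_nonneg hq0.le (norm_nonneg y)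
      · rw [hnorm hx0, hnorm hy0] at hlt ⊢
        have h1 : y.valuation < x.valuation :=
          (zpow_lt_zpow_iff_right_of_lt_one₀ hq0 hq1).mp hlt
        calc q ^ x.valuation ≤ q ^ (y.valuation + 1) :=
              zpow_le_zpow_right_of_le_one₀ hq0 hq1.le (by omega)
          _ = q * q ^ y.valuation := by rw [zpow_add_one₀ hq0.ne', mul_comm]
    have hqY : 0 ≤ q * ‖y‖ := mul_nonneg hq0.le (norm_nonneg y)
    have hrest : ‖(f.a : ℚ_[p]) * x ^ 4 + (f.b : ℚ_[p]) * x ^ 3 * y +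
        (f.c : ℚ_[p]) * x ^ 2 * y ^ 2 + (f.d : ℚ_[p]) * x * y ^ 3‖ ≤ q ^ 4 * ‖y‖ ^ 4 := by
      have hx1 : ‖x‖ ^ 4 ≤ (q * ‖y‖) ^ 4 := pow_le_pow_left₀ (norm_nonneg x) hXt 4
      have hx2 : ‖x‖ ^ 3 ≤ (q * ‖y‖) ^ 3 := pow_le_pow_left₀ (norm_nonneg x) hXt 3
      have hx3 : ‖x‖ ^ 2 ≤ (q * ‖y‖) ^ 2 := pow_le_pow_left₀ (norm_nonneg x) hXt 2
      refine norm_add_le_of_le' (norm_add_le_of_le' (norm_add_le_of_le' (n1.le.trans ?_)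
        (n2.trans ?_)) (n3.trans ?_)) (n4.trans ?_)
      · calc q * ‖x‖ ^ 4 ≤ q * (q * ‖y‖) ^ 4 := mul_le_mul_of_nonneg_left hx1 hq0.le
          _ = q ^ 5 * ‖y‖ ^ 4 := by ring
          _ ≤ q ^ 4 * ‖y‖ ^ 4 := mul_le_mul_of_nonneg_right hq54 hY4.le
      · calc q ^ 2 * ‖x‖ ^ 3 * ‖y‖ ≤ q ^ 2 * (q * ‖y‖) ^ 3 * ‖y‖ :=
              mul_le_mul_of_nonneg_right (mul_le_mul_of_nonneg_left hx2 (pow_nonneg hq0.le 2))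
                (norm_nonneg y)
          _ = q ^ 5 * ‖y‖ ^ 4 := by ring
          _ ≤ q ^ 4 * ‖y‖ ^ 4 := mul_le_mul_of_nonneg_right hq54 hY4.le
      · calc q ^ 2 * ‖x‖ ^ 2 * ‖y‖ ^ 2 ≤ q ^ 2 * (q * ‖y‖) ^ 2 * ‖y‖ ^ 2 :=
              mul_le_mul_of_nonneg_right (mul_le_mul_of_nonneg_left hx3 (pow_nonneg hq0.le 2))
                (pow_nonneg (norm_nonneg y) 2)
          _ = q ^ 4 * ‖y‖ ^ 4 := by ring
      · calc q ^ 3 * ‖x‖ * ‖y‖ ^ 3 ≤ q ^ 3 * (q * ‖y‖) * ‖y‖ ^ 3 :=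
              mul_le_mul_of_nonneg_right (mul_le_mul_of_nonneg_left hXt hq3.le)
                (pow_nonneg (norm_nonneg y) 3)
          _ = q ^ 4 * ‖y‖ ^ 4 := by ring
    have hmain_gt : ‖(f.a : ℚ_[p]) * x ^ 4 + (f.b : ℚ_[p]) * x ^ 3 * y +
        (f.c : ℚ_[p]) * x ^ 2 * y ^ 2 + (f.d : ℚ_[p]) * x * y ^ 3‖ < ‖(f.e : ℚ_[p]) * y ^ 4‖ := by
      rw [n5]
      exact hrest.trans_lt (mul_lt_mul_of_pos_right hq43 hY4)
    have hval : ‖(f.map (Int.castRingHom ℚ_[p])).eval x y‖ = q ^ 3 * ‖y‖ ^ 4 := by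
      rw [hQ, add_comm ((f.a : ℚ_[p]) * x ^ 4 + (f.b : ℚ_[p]) * x ^ 3 * y +
          (f.c : ℚ_[p]) * x ^ 2 * y ^ 2 + (f.d : ℚ_[p]) * x * y ^ 3),
        Padic.add_eq_max_of_ne hmain_gt.ne', max_eq_left hmain_gt.le, n5]
    have hz0 : z ≠ 0 := by
      rintro rfl
      have h0 : ‖(f.map (Int.castRingHom ℚ_[p])).eval x y‖ = 0 := by rw [← hz]; simp
      rw [hval] at h0
      exact (mul_pos hq3 hY4).ne' h0
    have key : q ^ (z.valuation * (2 : ℕ)) = q ^ ((3 : ℕ) + y.valuation * (4 : ℕ)) := by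
      have h1 : ‖z ^ 2‖ = q ^ 3 * ‖y‖ ^ 4 := by rw [hz, hval]
      rwa [norm_pow, hnorm hz0, hnorm hy0, ← zpow_natCast (q ^ z.valuation) 2, ← zpow_mul,
        ← zpow_natCast (q ^ y.valuation) 4, ← zpow_mul, ← zpow_natCast q 3,
        ← zpow_add₀ hq0.ne'] at h1
    have h2 := hinj key
    push_cast at h2
    omega

end Insoluble

/-! ## §E Assembly: Stoll–Cremona Prop. A.3 = Birch–Swinnerton-Dyer Lemma 3 -/

section Assembly

/-- **Birch–Swinnerton-Dyer, Lemma 3 = Bhargava–Shankar, Lemma 5.3 = Stoll–Cremona, Prop. A.3,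
proved**: for a prime `p ≥ 5` and an integral binary quartic form `f` with `p⁴ ∣ I(f)`,
`p⁶ ∣ J(f)` and `z² = f(x, y)` soluble over `ℚ_p`, there is an integral form `f'`, equivalent to
`f` over `ℚ`, with invariants `p⁻⁴ I(f)`, `p⁻⁶ J(f)`
(`Literature.NumberTheory.EllipticCurves.bsd_minimisation_prime_five_le`). Proof (Stoll–Cremona,
Appendix A): if `v(Q) ≥ 2` divide by `p²` (Lemma A.1(3)). Otherwise the reduction of `Q`
(resp. of `Q/p` when `v(Q) = 1`) is a nonzero form with `I ≡ J ≡ 0`, hence has a root of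
multiplicity `≥ 3` over `𝔽_p`, moved to `0` with the other root at `∞` by an `SL₂(ℤ)` change
(`exists_sl2_shape`). Quadruple root, `v(Q) = 0`: the valuations of `I`, `J`, `6cI − J` force
`v ≥ (0,1,2,3,4)` and `Q(x, z/p)` works (Lemma A.1(1)). Triple root, `v(Q) = 0`: after a shear
making `v(c) ≥ 2`, `v ≥ (1,0,2,4,6)` and `p² Q(x, z/p²)` works (Lemma A.1(2)). Triple root,
`v(Q) = 1`: the same shear on `Q/p` gives `v(Q) ≥ (2,1,3,3,4)`. Quadruple root, `v(Q) = 1`: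
`v ≥ (1,2,2,3,3)` from the invariants, and `v(e) = 3` is excluded by `ℚ_p`-solubility
(`not_isSoluble_of_valuations`), so again `Q(x, z/p)` is integral.
[cite: StollCremona2002, Prop. A.3 and Lemmas A.1, A.2] -/
theorem bsd_minimisation_prime_five_le_holds : bsd_minimisation_prime_five_le := by
  intro p hpF hp5 f hI hJ hsol
  have hp : p.Prime := hpF.out
  have hP : Prime (p : ℤ) := Nat.prime_iff_prime_int.mp hp
  have hP0 : (p : ℤ) ≠ 0 := hP.ne_zero
  have hp2 : ¬ (p : ℤ) ∣ 2 := fun h ↦ by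
    have := Int.le_of_dvd two_pos h; omega
  have hp3 : ¬ (p : ℤ) ∣ 3 := fun h ↦ by
    have := Int.le_of_dvd (by norm_num) h; omega
  -- unimodular integral substitutions: equivalence, solubility, invariants
  have kequiv_of_det : ∀ (g : BinaryQuartic ℤ) (M : Matrix (Fin 2) (Fin 2) ℤ), M.det = 1 →
      KEquiv (g.map (Int.castRingHom ℚ)) ((g.subst M).map (Int.castRingHom ℚ)) :=
    fun g M hM ↦ (GL2ZEquiv.pgl2Equiv_map ⟨M, by rw [hM]; exact isUnit_one, rfl⟩).kEquiv
  have sol_of_det : ∀ (g : BinaryQuartic ℤ) (M : Matrix (Fin 2) (Fin 2) ℤ), M.det = 1 →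
      (g.map (Int.castRingHom ℚ_[p])).IsSoluble →
        ((g.subst M).map (Int.castRingHom ℚ_[p])).IsSoluble := by
    intro g M hM hs
    rw [map_subst, isSoluble_subst_iff]
    · exact hs
    · rw [det_map_ringHom, hM, map_one]; exact one_ne_zero
  have I_of_det : ∀ (g : BinaryQuartic ℤ) (M : Matrix (Fin 2) (Fin 2) ℤ), M.det = 1 →
      (g.subst M).I = g.I := fun g M hM ↦ by rw [I_subst, hM, one_pow, one_mul]
  have J_of_det : ∀ (g : BinaryQuartic ℤ) (M : Matrix (Fin 2) (Fin 2) ℤ), M.det = 1 →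
      (g.subst M).J = g.J := fun g M hM ↦ by rw [J_subst, hM, one_pow, one_mul]
  -- the shear step shared by the two triple-root cases: from `v ≥ (1,0,1,1,1)`, `v(b) = 0`,
  -- to `v ≥ (1,0,2,1,1)`, `v(b) = 0`
  have shear : ∀ h : BinaryQuartic ℤ, (p : ℤ) ∣ h.a → ¬ (p : ℤ) ∣ h.b → (p : ℤ) ∣ h.c →
      (p : ℤ) ∣ h.d → (p : ℤ) ∣ h.e → ∃ (r : ℤ) (h' : BinaryQuartic ℤ),
        h.subst !![1, 0; r, 1] = h' ∧
        (p : ℤ) ∣ h'.a ∧ ¬ (p : ℤ) ∣ h'.b ∧ (p : ℤ) ^ 2 ∣ h'.c ∧ (p : ℤ) ∣ h'.d ∧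
          (p : ℤ) ∣ h'.e := by
    intro h ha hb hc hd he
    obtain ⟨r, hr, hrc⟩ := exists_shear hP hp3 hb hc
    refine ⟨r, _, (subst_lowerShear h r), ha, ?_, ?_, ?_, ?_⟩
    · intro h'
      exact hb ((dvd_add_right (hr.mul_left (4 * h.a))).mp h')
    · show (p : ℤ) ^ 2 ∣ 6 * h.a * r ^ 2 + 3 * h.b * r + h.c
      rw [add_assoc]
      exact dvd_add ((pow_dvd_pow_of_dvd hr 2).mul_left (6 * h.a)) hrc
    · show (p : ℤ) ∣ 4 * h.a * r ^ 3 + 3 * h.b * r ^ 2 + 2 * h.c * r + h.d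
      refine dvd_add (dvd_add (dvd_add ?_ ?_) ?_) hd
      · exact (dvd_pow hr three_ne_zero).mul_left _
      · exact (dvd_pow hr two_ne_zero).mul_left _
      · exact hr.mul_left _
    · show (p : ℤ) ∣ h.a * r ^ 4 + h.b * r ^ 3 + h.c * r ^ 2 + h.d * r + h.e
      refine dvd_add (dvd_add (dvd_add (dvd_add ?_ ?_) ?_) ?_) he
      · exact (dvd_pow hr four_ne_zero).mul_left _
      · exact (dvd_pow hr three_ne_zero).mul_left _
      · exact (dvd_pow hr two_ne_zero).mul_left _
      · exact hr.mul_left _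
  by_cases h2all : (p : ℤ) ^ 2 ∣ f.a ∧ (p : ℤ) ^ 2 ∣ f.b ∧ (p : ℤ) ^ 2 ∣ f.c ∧
      (p : ℤ) ^ 2 ∣ f.d ∧ (p : ℤ) ^ 2 ∣ f.e
  · -- `v(Q) ≥ 2`: Lemma A.1(3)
    obtain ⟨ha, hb, hc, hd, he⟩ := h2all
    exact reduce_three hP0 f ha hb hc hd he
  by_cases h1all : (p : ℤ) ∣ f.a ∧ (p : ℤ) ∣ f.b ∧ (p : ℤ) ∣ f.c ∧ (p : ℤ) ∣ f.d ∧ (p : ℤ) ∣ f.e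
  · -- `v(Q) = 1`: `f = p f₀`
    obtain ⟨⟨a₀, ha₀⟩, ⟨b₀, hb₀⟩, ⟨c₀, hc₀⟩, ⟨d₀, hd₀⟩, ⟨e₀, he₀⟩⟩ := h1all
    have hff₀ : f = (p : ℤ) • (⟨a₀, b₀, c₀, d₀, e₀⟩ : BinaryQuartic ℤ) := by
      ext
      · exact ha₀
      · exact hb₀
      · exact hc₀
      · exact hd₀
      · exact he₀
    have hf₀v : ¬ ((p : ℤ) ∣ a₀ ∧ (p : ℤ) ∣ b₀ ∧ (p : ℤ) ∣ c₀ ∧ (p : ℤ) ∣ d₀ ∧ (p : ℤ) ∣ e₀) := by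
      rintro ⟨h₁, h₂, h₃, h₄, h₅⟩
      apply h2all
      rw [ha₀, hb₀, hc₀, hd₀, he₀, sq]
      exact ⟨mul_dvd_mul_left _ h₁, mul_dvd_mul_left _ h₂, mul_dvd_mul_left _ h₃,
        mul_dvd_mul_left _ h₄, mul_dvd_mul_left _ h₅⟩
    have hI₀ : (p : ℤ) ^ 2 ∣ (⟨a₀, b₀, c₀, d₀, e₀⟩ : BinaryQuartic ℤ).I := by
      have h4 : (p : ℤ) ^ 2 * (p : ℤ) ^ 2 ∣ (p : ℤ) ^ 2 * (⟨a₀, b₀, c₀, d₀, e₀⟩ : BinaryQuartic ℤ).I := by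
        have := hI
        rw [hff₀, I_smul] at this
        calc (p : ℤ) ^ 2 * (p : ℤ) ^ 2 = (p : ℤ) ^ 4 := by ring
          _ ∣ _ := this
      exact (mul_dvd_mul_iff_left (pow_ne_zero 2 hP0)).mp h4
    have hJ₀ : (p : ℤ) ^ 3 ∣ (⟨a₀, b₀, c₀, d₀, e₀⟩ : BinaryQuartic ℤ).J := by
      have h6 : (p : ℤ) ^ 3 * (p : ℤ) ^ 3 ∣ (p : ℤ) ^ 3 * (⟨a₀, b₀, c₀, d₀, e₀⟩ : BinaryQuartic ℤ).J := by
        have := hJ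
        rw [hff₀, J_smul] at this
        calc (p : ℤ) ^ 3 * (p : ℤ) ^ 3 = (p : ℤ) ^ 6 := by ring
          _ ∣ _ := this
      exact (mul_dvd_mul_iff_left (pow_ne_zero 3 hP0)).mp h6
    obtain ⟨M, hMdet, hshape⟩ := exists_sl2_shape hp5 (⟨a₀, b₀, c₀, d₀, e₀⟩ : BinaryQuartic ℤ)
      hf₀v ((dvd_pow_self _ two_ne_zero).trans hI₀) ((dvd_pow_self _ three_ne_zero).trans hJ₀)
    -- `h = f₀ · M`, `f · M = p h`
    obtain ⟨h, hh⟩ : ∃ h : BinaryQuartic ℤ, (⟨a₀, b₀, c₀, d₀, e₀⟩ : BinaryQuartic ℤ).subst M = h :=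
      ⟨_, rfl⟩
    have hfM : f.subst M = (p : ℤ) • h := by rw [hff₀, smul_subst, hh]
    have hIh : (p : ℤ) ^ 2 ∣ h.I := by rw [← hh, I_of_det _ M hMdet]; exact hI₀
    have hJh : (p : ℤ) ^ 3 ∣ h.J := by rw [← hh, J_of_det _ M hMdet]; exact hJ₀
    rw [hh] at hshape
    rcases hshape with ⟨ha, hb, hc, hd, he⟩ | ⟨ha, hb, hc, hd, he⟩
    · -- quadruple root, `v(Q) = 1` (Prop. A.3(4))
      obtain ⟨f₁, hf₁⟩ : ∃ f₁ : BinaryQuartic ℤ, f.subst M = f₁ := ⟨_, rfl⟩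
      have e_a : f₁.a = p * h.a := by rw [← hf₁, hfM, smul_a]
      have hb₁ : (p : ℤ) ^ 2 ∣ f₁.b := by rw [← hf₁, hfM, smul_b, sq]; exact mul_dvd_mul_left _ hb
      have hc₁ : (p : ℤ) ^ 2 ∣ f₁.c := by rw [← hf₁, hfM, smul_c, sq]; exact mul_dvd_mul_left _ hc
      have hd₁ : (p : ℤ) ^ 2 ∣ f₁.d := by rw [← hf₁, hfM, smul_d, sq]; exact mul_dvd_mul_left _ hd
      have he₁ : (p : ℤ) ^ 2 ∣ f₁.e := by rw [← hf₁, hfM, smul_e, sq]; exact mul_dvd_mul_left _ he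
      have hIf₁ : f₁.I = f.I := by rw [← hf₁, I_of_det f M hMdet]
      have hJf₁ : f₁.J = f.J := by rw [← hf₁, J_of_det f M hMdet]
      have hI₁ : (p : ℤ) ^ 4 ∣ f₁.I := by rw [hIf₁]; exact hI
      have hJ₁ : (p : ℤ) ^ 6 ∣ f₁.J := by rw [hJf₁]; exact hJ
      obtain ⟨hd3, he3⟩ := chase_quadruple₁ hP hp2 hp3 e_a ha hb₁ hc₁ hd₁ he₁
        (by simpa only [I] using hI₁) (by simpa only [J] using hJ₁)
      have he4 : (p : ℤ) ^ 4 ∣ f₁.e := by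
        by_contra hne
        obtain ⟨e₃, he₃⟩ := he3
        have he₃' : ¬ (p : ℤ) ∣ e₃ := fun h' ↦
          hne (by rw [he₃, show (4 : ℕ) = 3 + 1 from rfl, pow_succ]; exact mul_dvd_mul_left _ h')
        exact not_isSoluble_of_valuations f₁ e_a ha hb₁ hc₁ hd3 he₃ he₃'
          (by rw [← hf₁]; exact sol_of_det f M hMdet hsol)
      obtain ⟨f', hK, hI', hJ'⟩ :=
        reduce_one hP0 f₁ ((dvd_pow_self _ two_ne_zero).trans hb₁) hc₁ hd3 he4
      refine ⟨f', ?_, by rw [hI', hIf₁], by rw [hJ', hJf₁]⟩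
      have := kequiv_of_det f M hMdet
      rw [hf₁] at this
      exact TwoCovering.kEquiv_trans this hK
    · -- triple root, `v(Q) = 1` (Lemma A.2, case `v(Q) = 1`)
      obtain ⟨r, h', hh', ha', hb', hc', hd', he'⟩ := shear h ha hb hc hd he
      have hLdet : (!![1, 0; r, 1] : Matrix (Fin 2) (Fin 2) ℤ).det = 1 := det_lowerShear r
      have hI' : (p : ℤ) ^ 2 ∣ h'.I := by rw [← hh', I_of_det h _ hLdet]; exact hIh
      have hJ' : (p : ℤ) ^ 3 ∣ h'.J := by rw [← hh', J_of_det h _ hLdet]; exact hJh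
      obtain ⟨hd2, he3⟩ := chase_triple₁ hP hp2 hp3 ha' hb' hc' hd' he'
        (by simpa only [I] using hI') (by simpa only [J] using hJ')
      have hLM : (!![1, 0; r, 1] * M).det = 1 := by rw [Matrix.det_mul, hLdet, hMdet, one_mul]
      obtain ⟨f₂, hf₂⟩ : ∃ f₂ : BinaryQuartic ℤ, f.subst (!![1, 0; r, 1] * M) = f₂ := ⟨_, rfl⟩
      have hf₂' : f₂ = (p : ℤ) • h' := by rw [← hf₂, subst_mul, hfM, smul_subst, hh']
      have hb₂ : (p : ℤ) ∣ f₂.b := by rw [hf₂', smul_b]; exact dvd_mul_right _ _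
      have hc₂ : (p : ℤ) ^ 2 ∣ f₂.c := by
        rw [hf₂', smul_c, sq]; exact mul_dvd_mul_left _ ((dvd_pow_self _ two_ne_zero).trans hc')
      have hd₂ : (p : ℤ) ^ 3 ∣ f₂.d := by
        rw [hf₂', smul_d, show (3 : ℕ) = 2 + 1 from rfl, pow_succ, mul_comm ((p : ℤ) ^ 2)]
        exact mul_dvd_mul_left _ hd2
      have he₂ : (p : ℤ) ^ 4 ∣ f₂.e := by
        rw [hf₂', smul_e, show (4 : ℕ) = 3 + 1 from rfl, pow_succ, mul_comm ((p : ℤ) ^ 3)]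
        exact mul_dvd_mul_left _ he3
      have hIf₂ : f₂.I = f.I := by rw [← hf₂, I_of_det f _ hLM]
      have hJf₂ : f₂.J = f.J := by rw [← hf₂, J_of_det f _ hLM]
      obtain ⟨f', hK, hI', hJ'⟩ := reduce_one hP0 f₂ hb₂ hc₂ hd₂ he₂
      refine ⟨f', ?_, by rw [hI', hIf₂], by rw [hJ', hJf₂]⟩
      have := kequiv_of_det f _ hLM
      rw [hf₂] at this
      exact TwoCovering.kEquiv_trans this hK
  · -- `v(Q) = 0`
    obtain ⟨M, hMdet, hshape⟩ := exists_sl2_shape hp5 f h1all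
      ((dvd_pow_self _ four_ne_zero).trans hI) ((dvd_pow_self _ (by norm_num)).trans hJ)
    obtain ⟨f₁, hf₁⟩ : ∃ f₁ : BinaryQuartic ℤ, f.subst M = f₁ := ⟨_, rfl⟩
    have hIf₁ : f₁.I = f.I := by rw [← hf₁, I_of_det f M hMdet]
    have hJf₁ : f₁.J = f.J := by rw [← hf₁, J_of_det f M hMdet]
    have hI₁ : (p : ℤ) ^ 4 ∣ f₁.I := by rw [hIf₁]; exact hI
    have hJ₁ : (p : ℤ) ^ 6 ∣ f₁.J := by rw [hJf₁]; exact hJ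
    have hK₁ : KEquiv (f.map (Int.castRingHom ℚ)) (f₁.map (Int.castRingHom ℚ)) := by
      rw [← hf₁]; exact kequiv_of_det f M hMdet
    rw [hf₁] at hshape
    rcases hshape with ⟨ha, hb, hc, hd, he⟩ | ⟨ha, hb, hc, hd, he⟩
    · -- quadruple root, `v(Q) = 0` (Prop. A.3(3))
      obtain ⟨hc2, hd3, he4⟩ := chase_quadruple₀ hP hp2 hp3 ha hb hc hd he
        (by simpa only [I] using hI₁) (by simpa only [J] using hJ₁)
      obtain ⟨f', hK, hI', hJ'⟩ := reduce_one hP0 f₁ hb hc2 hd3 he4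
      exact ⟨f', TwoCovering.kEquiv_trans hK₁ hK, by rw [hI', hIf₁], by rw [hJ', hJf₁]⟩
    · -- triple root, `v(Q) = 0` (Lemma A.2, case `v(Q) = 0`)
      obtain ⟨r, f₂, hf₂, ha', hb', hc', hd', he'⟩ := shear f₁ ha hb hc hd he
      have hLdet : (!![1, 0; r, 1] : Matrix (Fin 2) (Fin 2) ℤ).det = 1 := det_lowerShear r
      have hIf₂ : f₂.I = f.I := by rw [← hf₂, I_of_det f₁ _ hLdet, hIf₁]
      have hJf₂ : f₂.J = f.J := by rw [← hf₂, J_of_det f₁ _ hLdet, hJf₁]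
      have hI₂ : (p : ℤ) ^ 4 ∣ f₂.I := by rw [hIf₂]; exact hI
      have hJ₂ : (p : ℤ) ^ 6 ∣ f₂.J := by rw [hJf₂]; exact hJ
      obtain ⟨hd4, he6⟩ := chase_triple₀ hP hp2 hp3 ha' hb' hc' hd' he'
        (by simpa only [I] using hI₂) (by simpa only [J] using hJ₂)
      obtain ⟨f', hK, hI', hJ'⟩ := reduce_two hP0 f₂ hc' hd4 he6
      have hK₂ : KEquiv (f₁.map (Int.castRingHom ℚ)) (f₂.map (Int.castRingHom ℚ)) := by
        rw [← hf₂]; exact kequiv_of_det f₁ _ hLdet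
      exact ⟨f', TwoCovering.kEquiv_trans hK₁ (TwoCovering.kEquiv_trans hK₂ hK),
        by rw [hI', hIf₂], by rw [hJ', hJf₂]⟩

end Assembly

end BinaryQuartic

/-- Re-export at the level of the named fact's namespace: **Bhargava–Shankar Lemma 5.3 /
Birch–Swinnerton-Dyer Lemma 3 holds** (`bsd_minimisation_prime_five_le`).
[cite: BhargavaShankarAnnals2015, Lemma 5.3 (arXiv:1006.1002v2 numbering)] -/
theorem bsd_minimisation_prime_five_le_holds : bsd_minimisation_prime_five_le :=
  BinaryQuartic.bsd_minimisation_prime_five_le_holds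

end Literature.NumberTheory.EllipticCurves

end
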